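import Literature.RepresentationTheory.HeisenbergGroup.HeisenbergCoboundary
import HarnessLib

/-!
# A Heisenberg group generated by two commuting sub-Heisenberg groups (`H_𝐀(W) = H(W_∞) · H(W_fin)`)

Topic `RepresentationTheory/HeisenbergGroup`; theorems only (no definition, no named fact).

[GelbartRogawski1991, §3.1 p. 454 L17–21, L28]: the Heisenberg group `H(W) = W ⊕ F` of a symplectic space,
its adelic points `H_𝐀(W)` and, "defined similarly", its local versions.  Since `𝐀 = 𝐀_∞ × 𝐀_fin` and
`W_𝐀 = W_∞ × W_fin` with the symplectic form the SUM of an archimedean and a finite-adelic form with no cross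
terms, `H_𝐀(W)` contains commuting copies of `H(W_∞)` and `H(W_fin)` which generate it.  This file proves the
abstract form of that bookkeeping for the tree's `Heisenberg B` and the functoriality `Heisenberg.map` of
`HeisenbergCoboundary`: given a Heisenberg group `Heisenberg C` over `R`, two Heisenberg groups
`Heisenberg B₁`, `Heisenberg B₂` over `R₁`, `R₂` and additive maps `jᵢ : Vᵢ → V`, `kᵢ : Rᵢ → R` compatible with
the forms (`C (jᵢ v) (jᵢ w) = kᵢ (Bᵢ v w)`) whose images are `C`-ORTHOGONAL (`C (j₁ v₁) (j₂ v₂) = 0 = C (j₂ v₂) (j₁ v₁)`):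
* `map_mul_map_comm` — the images `ι₁ = map C j₁ k₁`, `ι₂ = map C j₂ k₂` COMMUTE;
* `exists_eq_map_mul_map` — if `V = j₁(V₁) + j₂(V₂)` and `R = k₁(R₁) + k₂(R₂)` then every `g ∈ Heisenberg C` is
  `ι₁ h₁ · ι₂ h₂` (the hypothesis `hgen` of `HeisenbergPairUniqueness` §3: `apply_mem_of_generated`,
  `jointly_irreducible_of_generated`, `intertwines_of_generated`);
* `map_ofCenter_mul_map_ofCenter` — the centre of `Heisenberg C` is reached by the two centres.
This is step (a) of the adelic assembly for "(`ρ_ψ` is unique up to isomorphism)" (see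
`AdelicShapeUniqueness`): with `ι_∞`, `ι_fin` the maps of `W_∞ = 𝐀_∞ ⊗_F V`, `W_fin = 𝐀_fin ⊗_F V` into
`W_𝐀 = 𝐀 ⊗_F V`, a representation of `H_𝐀(W)` is the same as a commuting pair of representations of
`H(W_∞)` and `H(W_fin)`.

## References

* S. Gelbart, J. Rogawski, Invent. Math. 105 (1991), §3.1 p. 454 L17–21, L28. [GelbartRogawski1991]
* A. Weil, *Sur certains groupes d'opérateurs unitaires*, Acta Math. 111 (1964), Chap. I n° 3–4, Chap. III n° 37.
  [Weil1964]
-/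

noncomputable section

namespace Literature.RepresentationTheory.HeisenbergGroup

namespace Heisenberg

variable {R R₁ R₂ : Type*} [CommRing R] [CommRing R₁] [CommRing R₂]
  {V V₁ V₂ : Type*} [AddCommGroup V] [Module R V] [AddCommGroup V₁] [Module R₁ V₁]
  [AddCommGroup V₂] [Module R₂ V₂]
  (C : V →ₗ[R] V →ₗ[R] R) (B₁ : V₁ →ₗ[R₁] V₁ →ₗ[R₁] R₁) (B₂ : V₂ →ₗ[R₂] V₂ →ₗ[R₂] R₂)
  {j₁ : V₁ →+ V} {k₁ : R₁ →+ R} {j₂ : V₂ →+ V} {k₂ : R₂ →+ R}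
  (hjk₁ : ∀ v w : V₁, C (j₁ v) (j₁ w) = k₁ (B₁ v w)) (hjk₂ : ∀ v w : V₂, C (j₂ v) (j₂ w) = k₂ (B₂ v w))
  (h₁₂ : ∀ (v₁ : V₁) (v₂ : V₂), C (j₁ v₁) (j₂ v₂) = 0) (h₂₁ : ∀ (v₁ : V₁) (v₂ : V₂), C (j₂ v₂) (j₁ v₁) = 0)

include h₁₂ h₂₁ in
/-- **the two factor Heisenberg groups commute inside `Heisenberg C`** when their images are `C`-orthogonal
(`(a, 0) · (0, b) = 0` in `𝐀 = 𝐀_∞ × 𝐀_fin`). [cite: GelbartRogawski1991, §3.1 p. 454 L17–21] -/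
theorem map_mul_map_comm (h₁ : Heisenberg B₁) (h₂ : Heisenberg B₂) :
    map C j₁ k₁ hjk₁ h₁ * map C j₂ k₂ hjk₂ h₂ = map C j₂ k₂ hjk₂ h₂ * map C j₁ k₁ hjk₁ h₁ := by
  apply Heisenberg.ext
  · rw [mul_v, mul_v, map_apply_v, map_apply_v, add_comm]
  · rw [mul_t, mul_t, map_apply_v, map_apply_v, map_apply_t, map_apply_t, h₁₂, h₂₁, add_zero, add_zero,
      add_comm]

include h₁₂ in
/-- the product of an element of each factor: `ι₁(v₁, t₁) · ι₂(v₂, t₂) = (j₁ v₁ + j₂ v₂, k₁ t₁ + k₂ t₂)`.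
[cite: Weil1964, Chap. I n° 3–4] -/
theorem map_mul_map_eq (h₁ : Heisenberg B₁) (h₂ : Heisenberg B₂) :
    map C j₁ k₁ hjk₁ h₁ * map C j₂ k₂ hjk₂ h₂ = ⟨j₁ h₁.v + j₂ h₂.v, k₁ h₁.t + k₂ h₂.t⟩ := by
  apply Heisenberg.ext
  · rw [mul_v, map_apply_v, map_apply_v]
  · rw [mul_t, map_apply_v, map_apply_v, map_apply_t, map_apply_t, h₁₂, add_zero]

include h₁₂ in
/-- **the two factors generate**: if `V = j₁(V₁) + j₂(V₂)` and `R = k₁(R₁) + k₂(R₂)` (as for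
`W_𝐀 = W_∞ × W_fin`, `𝐀 = 𝐀_∞ × 𝐀_fin`), every element of `Heisenberg C` is a product `ι₁ h₁ · ι₂ h₂` — the
hypothesis `hgen` of `HeisenbergPairUniqueness.apply_mem_of_generated` / `jointly_irreducible_of_generated` /
`intertwines_of_generated`. [cite: GelbartRogawski1991, §3.1 p. 454 L17–21] -/
theorem exists_eq_map_mul_map (hV : ∀ v : V, ∃ (v₁ : V₁) (v₂ : V₂), v = j₁ v₁ + j₂ v₂)
    (hR : ∀ t : R, ∃ (t₁ : R₁) (t₂ : R₂), t = k₁ t₁ + k₂ t₂) (g : Heisenberg C) :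
    ∃ (h₁ : Heisenberg B₁) (h₂ : Heisenberg B₂), g = map C j₁ k₁ hjk₁ h₁ * map C j₂ k₂ hjk₂ h₂ := by
  obtain ⟨v₁, v₂, hv⟩ := hV g.v
  obtain ⟨t₁, t₂, ht⟩ := hR g.t
  refine ⟨⟨v₁, t₁⟩, ⟨v₂, t₂⟩, ?_⟩
  rw [map_mul_map_eq C B₁ B₂ hjk₁ hjk₂ h₁₂]
  exact Heisenberg.ext hv ht

/-- the centres of the factors multiply to the centre: `ι₁(0, t₁) · ι₂(0, t₂) = (0, k₁ t₁ + k₂ t₂)`.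
[cite: Weil1964, Chap. I n° 3–4] -/
theorem map_ofCenter_mul_map_ofCenter (t₁ : R₁) (t₂ : R₂) :
    map C j₁ k₁ hjk₁ (ofCenter B₁ (Multiplicative.ofAdd t₁)) *
        map C j₂ k₂ hjk₂ (ofCenter B₂ (Multiplicative.ofAdd t₂)) =
      ofCenter C (Multiplicative.ofAdd (k₁ t₁ + k₂ t₂)) := by
  apply Heisenberg.ext
  · rw [mul_v, map_apply_v, map_apply_v, ofCenter_v, ofCenter_v, ofCenter_v, map_zero, map_zero, add_zero]
  · rw [mul_t, map_apply_v, map_apply_v, map_apply_t, map_apply_t, ofCenter_v, ofCenter_t, ofCenter_t,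
      ofCenter_t, map_zero, LinearMap.map_zero, LinearMap.zero_apply, add_zero]
    rfl

include h₁₂ in
/-- a representation-theoretic reading: an operator commuting with both images commutes with all of
`Heisenberg C` (under the generation hypotheses). [cite: Weil1964, Chap. I n° 3–4] -/
theorem forall_comm_of_comm_map {M : Type*} [Monoid M] (ρ : Heisenberg C →* M) (T : M)
    (hV : ∀ v : V, ∃ (v₁ : V₁) (v₂ : V₂), v = j₁ v₁ + j₂ v₂)
    (hR : ∀ t : R, ∃ (t₁ : R₁) (t₂ : R₂), t = k₁ t₁ + k₂ t₂)
    (hT₁ : ∀ h₁ : Heisenberg B₁, T * ρ (map C j₁ k₁ hjk₁ h₁) = ρ (map C j₁ k₁ hjk₁ h₁) * T)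
    (hT₂ : ∀ h₂ : Heisenberg B₂, T * ρ (map C j₂ k₂ hjk₂ h₂) = ρ (map C j₂ k₂ hjk₂ h₂) * T)
    (g : Heisenberg C) : T * ρ g = ρ g * T := by
  obtain ⟨h₁, h₂, rfl⟩ := exists_eq_map_mul_map C B₁ B₂ hjk₁ hjk₂ h₁₂ hV hR g
  rw [map_mul, ← mul_assoc, hT₁, mul_assoc, hT₂, mul_assoc]

end Heisenberg

end Literature.RepresentationTheory.HeisenbergGroup

end
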